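import Summits.KontsevichZagierPeriods.KontsevichZagierPeriods.Theorems.GammaHodgeSector.Negative.Canonical
import Summits.KontsevichZagierPeriods.KontsevichZagierPeriods.Theorems.GammaHodgeSector.Negative.FiniteTest

/-!
# `GammaHodgeSector` (stmt-KontsevichZagierPeriods-3742) — negative side VII: the crux is
Hodge-conjecture-hard (certificate: the Fermat fourfold of degree 33)

Line lead, seat c1 (2026-08-16). WHY NO LINE CLOSES THE ∀-CRUX, kernel-checked. The crux quantifies
over all Hodge-type Beta data of all levels and dimensions; by the telescoping of Dirichlet pairs it
therefore contains, for EVERY Hodge class `α ∈ 𝔅ⁿₘ` on EVERY Fermat variety `Xⁿₘ`, the assertion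
that the period relation `Π_i Γ(a_i/m) ∈ ℚ̄ · π^{n/2+1}` of `α` (Deligne 1982, Thm 7.18 — a theorem
about NUMBERS, proved in the tree as `deligne_gammaMonomial_algebraic_holds`) is realised by a chain
of Kontsevich–Zagier moves. The only known source of such a chain is an algebraic cycle (a
correspondence) representing the class. Here we certify the instance attached to da Silva's class
`α = (7,10,13,19,22,28)/33` on the Fermat FOURFOLD of degree `33` (arXiv:2101.04739, Prop. 3.6):
it is neither quasi-decomposable (Shioda's inductive structure fails) nor of Aoki's standard type,
no algebraic cycle representing it is known, and the Hodge conjecture for Fermat varieties of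
degree `33` is open (known: prime degree, `4`, `≤ 21`, `27`, `p²`; Shioda 1979, Aoki 1987,
da Silva 2021). So a proof of `GammaHodgeSector` must in particular produce calculus chains where
not even the algebraic cycles predicted by the Hodge conjecture are known — or a root-extraction /
cancellation principle of Conjecture-1 strength (line koblitz-ogus-halving's `PositiveRoots`).

Contents: the datum `x33, y33 : Fin 5 → ℚ` (`admissible_fermat33`); its Hodge-type test with
`k = 3` at `D = 33` by `decide` (`hodgeCondition_fermat33`); Deligne's condition for the monomial
(`isHodgeTypeGammaMonomial_fermat33`, via the finite form `isHodgeTypeGammaMonomial_of_lt`); the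
constant `c₃₃ = Π B / π³ = −4i·Γ̃` and its ALGEBRAICITY (`isAlgebraic_c33`, from
`deligne_gammaMonomial_algebraic_holds`); NON-VACUITY (`fermat33_nonvacuous`); and the extraction
`fermat33_of_gammaHodgeSector : GammaHodgeSector → cubeRep x33 y33 ∼ [B⁶, 6 c₃₃]`.
-/

noncomputable section

open MeasureTheory Set
open scoped BigOperators

namespace Summit.KontsevichZagierPeriods.GammaHodgeSectorNegative

open Literature.NumberTheory.Transcendental
open Literature.NumberTheory.Transcendental.KZ
open Summit.KontsevichZagierPeriods.KontsevichZagierPeriods.Theses.TerasomaMultiplication (GammaHodgeSector)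

/-! ## §13 The crux is Hodge-conjecture-hard: the Fermat fourfold of degree 33

Every Hodge class `α = (a₀,…,a_{n+1})/m ∈ 𝔅ⁿₘ` on the Fermat variety `Xⁿₘ ⊂ ℙⁿ⁺¹` (Shioda: `a_i ≢ 0`,
`Σ a_i ≡ 0 (m)`, `|tα| = n/2 + 1` for all `t ∈ (ℤ/m)ˣ`) yields an instance of the crux with
`(N, N', k) = (n+1, 0, n/2+1)`: the Dirichlet pairs `x_j = (a₀ + ⋯ + a_j)/m`, `y_j = a_{j+1}/m`
telescope, `Π_j B(x_j, y_j) = Π_i Γ(a_i/m) / Γ(Σ a_i/m)` is the integral of `Π t_i^{a_i/m − 1}` over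
the `(n+1)`-simplex — the period of the eigendifferential `ω_α` — and the Hodge-type test of the
crux at `u` is `Σ_i {u a_i/m} = |uα|`. Below: da Silva's class on `X⁴₃₃`. -/

section Fermat33

/-- da Silva's sextuple `{7, 10, 13, 19, 22, 28}`: the numerators of the character
`α = (7,10,13,19,22,28)/33` of the Fermat fourfold `X⁴₃₃`, a Hodge class (`α ∈ 𝔅⁴₃₃`) that is
neither quasi-decomposable (Shioda's inductive structure) nor of Aoki's standard type.
[cite: daSilva2021HodgeFermat, Prop. 3.6] -/
def fermat33 : Finset ℕ := {7, 10, 13, 19, 22, 28}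

/-- Multiplicities of the Γ-monomial `Γ(7/33)Γ(10/33)Γ(13/33)Γ(19/33)Γ(22/33)Γ(28/33)`:
the indicator of `fermat33`. [folklore] -/
def fermat33Mult (i : ℕ) : ℤ := if i ∈ fermat33 then 1 else 0

/-- The Dirichlet pairs of the sextuple: `x_j` = partial sums `7, 17, 30, 49, 71` over `33`. [folklore] -/
def x33 : Fin 5 → ℚ := ![7 / 33, 17 / 33, 30 / 33, 49 / 33, 71 / 33]

/-- The Dirichlet pairs of the sextuple: `y_j` = the next numerator `10, 13, 19, 22, 28` over `33`. [folklore] -/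
def y33 : Fin 5 → ℚ := ![10 / 33, 13 / 33, 19 / 33, 22 / 33, 28 / 33]

/-- The data are admissible (positive, non-integral). [folklore] -/
theorem admissible_fermat33 : Admissible x33 y33 := by
  unfold Admissible x33 y33
  decide +kernel

/-- **The level-33 Dirichlet data pass the Hodge-type test of the crux with `k = 3`** (`N = 5`,
`N' = 0`): for every `u` coprime to `33`, `Σ_j ({u x_j} + {u y_j} − {u(x_j + y_j)}) = 3` — the
finite form at `D = 33`, by `decide`. [folklore] -/
theorem hodgeCondition_fermat33 : HodgeCondition 5 0 3 x33 y33 Fin.elim0 Fin.elim0 := by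
  rw [hodgeCondition_iff_le (D := 33) (by norm_num) (by decide +kernel) (by decide +kernel) (by decide +kernel)
    (fun l => l.elim0) (fun l => l.elim0) (fun l => l.elim0)]
  unfold x33 y33 hodgeSum CoprimeDen
  decide +kernel

/-- Finite form of Deligne's Hodge-type condition on a Γ-monomial: the test is periodic in `u`
modulo `d`, so it reduces to `u ∈ [1, d)`. [folklore] -/
theorem isHodgeTypeGammaMonomial_of_lt {d : ℕ} (hd : 1 < d) {n : ℕ → ℤ} {c : ℤ}
    (h : ∀ u ∈ Finset.Ico 1 d, Nat.Coprime u d →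
      (∑ i ∈ Finset.Ico 1 d, (n i : ℚ) * Int.fract ((u : ℚ) * i / d)) = c) :
    IsHodgeTypeGammaMonomial d n c := by
  intro u hu
  have hd0 : 0 < d := by omega
  -- `u = u % d + d * (u / d)`, and `u % d ∈ [1, d)` since `u` is coprime to `d > 1`
  have hmod : u % d ≠ 0 := by
    intro h0
    have hdvd : d ∣ u := Nat.dvd_of_mod_eq_zero h0
    have : Nat.gcd u d = d := Nat.gcd_eq_right hdvd
    rw [Nat.Coprime] at hu
    omega
  have hmem : u % d ∈ Finset.Ico 1 d :=
    Finset.mem_Ico.mpr ⟨Nat.pos_of_ne_zero hmod, Nat.mod_lt u hd0⟩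
  have hcop : Nat.Coprime (u % d) d := by
    rw [Nat.Coprime, ← Nat.gcd_rec, Nat.gcd_comm]
    exact hu
  have key : ∀ i ∈ Finset.Ico 1 d,
      (n i : ℚ) * Int.fract ((u : ℚ) * i / d) = (n i : ℚ) * Int.fract (((u % d : ℕ) : ℚ) * i / d) := by
    intro i _
    congr 1
    have hdq : (d : ℚ) ≠ 0 := by exact_mod_cast hd0.ne'
    have hu' : (u : ℚ) = ((u % d : ℕ) : ℚ) + (d : ℚ) * ((u / d : ℕ) : ℚ) := by
      exact_mod_cast (Nat.mod_add_div u d).symm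
    generalize u / d = q at hu'
    rw [hu', show (((u % d : ℕ) : ℚ) + (d : ℚ) * (q : ℚ)) * i / d =
      ((u % d : ℕ) : ℚ) * i / d + ((q * i : ℕ) : ℚ) by push_cast; field_simp]
    exact Int.fract_add_natCast _ _
  rw [Finset.sum_congr rfl key]
  exact h (u % d) hmem hcop

/-- **Deligne's Hodge-type condition for da Silva's monomial**: `Σ_{i ∈ {7,10,13,19,22,28}} {u i/33} = 3`
for every `u` coprime to `33` (i.e. `α ∈ 𝔅⁴₃₃`, `|tα| = 3` for all `t ∈ (ℤ/33)ˣ`). [cite: daSilva2021HodgeFermat, Prop. 3.6] -/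
theorem isHodgeTypeGammaMonomial_fermat33 : IsHodgeTypeGammaMonomial 33 fermat33Mult 3 := by
  refine isHodgeTypeGammaMonomial_of_lt (by norm_num) ?_
  unfold fermat33Mult fermat33
  decide +kernel

/-- The Deligne–Koblitz–Ogus constant of the level-33 datum: `c₃₃ := Π_j B(x_j, y_j) / π³`. [folklore] -/
def c33 : ℝ := (∏ j, ProbabilityTheory.beta (x33 j) (y33 j)) / Real.pi ^ 3

/-- The Deligne identity of the datum holds for `c₃₃` (by its definition). [folklore] -/
theorem deligneIdentity_fermat33 : DeligneIdentity 3 x33 y33 Fin.elim0 Fin.elim0 c33 := by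
  have hπ : Real.pi ^ 3 ≠ 0 := by positivity
  unfold DeligneIdentity c33
  simp only [Finset.univ_eq_empty, Finset.prod_empty, mul_one]
  rw [div_mul_cancel₀ _ hπ]

/-- **The Beta chain telescopes to the Fermat period**:
`Π_j B(x_j, y_j) = Γ(7/33)Γ(10/33)Γ(13/33)Γ(19/33)Γ(22/33)Γ(28/33) / Γ(3)` (`x_{j+1} = x_j + y_j`,
`x_4 + y_4 = 3`, `Γ(3) = 2`) — the integral of `Π_i t_i^{a_i/33 − 1}` over the standard 5-simplex,
i.e. the period of the eigendifferential `ω_α` of `X⁴₃₃ ⊂ ℙ⁵` along the standard cycle. [folklore] -/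
theorem prod_beta_fermat33 :
    ∏ j, ProbabilityTheory.beta (x33 j) (y33 j) =
      Real.Gamma (7 / 33) * Real.Gamma (10 / 33) * Real.Gamma (13 / 33) * Real.Gamma (19 / 33) *
        Real.Gamma (22 / 33) * Real.Gamma (28 / 33) / 2 := by
  have h1 : Real.Gamma (17 / 33) ≠ 0 := (Real.Gamma_pos_of_pos (by norm_num)).ne'
  have h2 : Real.Gamma (10 / 11) ≠ 0 := (Real.Gamma_pos_of_pos (by norm_num)).ne'
  have h3 : Real.Gamma (49 / 33) ≠ 0 := (Real.Gamma_pos_of_pos (by norm_num)).ne'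
  have h4 : Real.Gamma (71 / 33) ≠ 0 := (Real.Gamma_pos_of_pos (by norm_num)).ne'
  simp only [Fin.prod_univ_five, x33, y33, ProbabilityTheory.beta]
  simp
  norm_num
  field_simp

/-- The normalised Γ-monomial of the datum: `Γ̃ = (2πi)^{−3} · Γ(7/33)Γ(10/33)Γ(13/33)Γ(19/33)Γ(22/33)Γ(28/33)`.
[folklore] -/
theorem gammaTilde_fermat33 :
    gammaTilde 33 fermat33Mult 3 =
      (2 * (Real.pi : ℂ) * Complex.I) ^ (-3 : ℤ) *
        ((Real.Gamma (7 / 33) * Real.Gamma (10 / 33) * Real.Gamma (13 / 33) * Real.Gamma (19 / 33) *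
          Real.Gamma (22 / 33) * Real.Gamma (28 / 33) : ℝ) : ℂ) := by
  unfold gammaTilde
  congr 1
  have key : ∀ i : ℕ, i ∈ Finset.Ico 1 33 →
      ((Real.Gamma ((i : ℝ) / ((33 : ℕ) : ℝ)) : ℂ)) ^ (fermat33Mult i) =
        if i ∈ fermat33 then ((Real.Gamma ((i : ℝ) / 33) : ℂ)) else 1 := by
    intro i _
    unfold fermat33Mult
    split_ifs <;> simp
  rw [Finset.prod_congr rfl key, Finset.prod_ite_mem,
    show Finset.Ico 1 33 ∩ fermat33 = fermat33 by decide]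
  simp [fermat33]
  ring

/-- `c₃₃ = −4i · Γ̃` as complex numbers (`(2πi)³ = −8π³ i`, `Γ(3) = 2`). [folklore] -/
theorem c33_eq : (c33 : ℂ) = -4 * Complex.I * gammaTilde 33 fermat33Mult 3 := by
  rw [gammaTilde_fermat33, c33, prod_beta_fermat33]
  have hπ : (Real.pi : ℂ) ≠ 0 := by exact_mod_cast Real.pi_ne_zero
  have h8 : (2 * (Real.pi : ℂ) * Complex.I) ^ 3 = -(8 * (Real.pi : ℂ) ^ 3) * Complex.I := by
    have : Complex.I ^ 3 = -Complex.I := by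
      rw [pow_succ, Complex.I_sq]; ring
    ring_nf
    rw [this]
    ring
  rw [zpow_neg, zpow_ofNat, h8]
  push_cast
  field_simp
  ring_nf

/-- `i` is algebraic. [folklore] -/
theorem isAlgebraic_complexI : IsAlgebraic ℚ Complex.I :=
  IsAlgebraic.of_pow two_pos (by rw [Complex.I_sq]; exact isAlgebraic_one.neg)

/-- **`c₃₃` is algebraic** — Deligne 1982 Thm 7.18 / Koblitz–Ogus for da Silva's monomial, from the
tree's PROVED `deligne_gammaMonomial_algebraic_holds` and the Hodge-type condition
`isHodgeTypeGammaMonomial_fermat33`. [cite: Deligne1982HodgeCycles, Thm. 7.18 (a)] -/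
theorem isAlgebraic_c33 : IsAlgebraic ℚ c33 := by
  have hT : IsAlgebraic ℚ (gammaTilde 33 fermat33Mult 3) :=
    deligne_gammaMonomial_algebraic_holds 33 fermat33Mult 3 (by norm_num) isHodgeTypeGammaMonomial_fermat33
  have h4 : IsAlgebraic ℚ (-4 * Complex.I : ℂ) := by
    have := ((isAlgebraic_nat (R := ℚ) (A := ℂ) 4).neg).mul isAlgebraic_complexI
    simpa using this
  have hc : IsAlgebraic ℚ ((c33 : ℝ) : ℂ) := by
    rw [c33_eq]
    exact h4.mul hT
  exact (isAlgebraic_algebraMap_iff (R := ℚ) (A := ℂ) (algebraMap ℝ ℂ).injective).mp hc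

/-- **NON-VACUITY of the level-33 instance**: representations pinned as in the crux with EQUAL values
exist for the datum `(5, 0, 3, x33, y33, c₃₃)` (canonical ones: `cubeRep x33 y33` and the 6-ball
`ballCubeRep 3 _ _ c₃₃`, values `Π B = c₃₃ π³`). [folklore] -/
theorem fermat33_nonvacuous :
    ∃ (r : IntegralRep 5) (r' : IntegralRep (2 * 3 + 0)),
      IsCubeBetaRep x33 y33 r ∧ IsBallCubeRep 3 Fin.elim0 Fin.elim0 c33 r' ∧ r.value = r'.value :=
  (exists_pinned_valueEq_iff 3 admissible_fermat33.pos admissible_elim0.pos c33).mpr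
    ⟨isAlgebraic_c33, deligneIdentity_fermat33⟩

/-- **THE CRUX IS HODGE-CONJECTURE-HARD (certificate).** `GammaHodgeSector` asserts, as its instance
`(N, N', k) = (5, 0, 3)` at level `33`, the KZ-EQUIVALENCE
`[(0,1)⁵, Π_j t_j^{x_j−1}(1−t_j)^{y_j−1}] ∼ [B⁶, 6·c₃₃]`, i.e. a chain of calculus moves realising
`Γ(7/33)Γ(10/33)Γ(13/33)Γ(19/33)Γ(22/33)Γ(28/33) = 2 c₃₃ · π³` — the period relation of da Silva's
Hodge class `α = (7,10,13,19,22,28)/33 ∈ 𝔅⁴₃₃` on the Fermat fourfold of degree `33`, which is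
neither quasi-decomposable nor of standard type, so that NO algebraic cycle representing it — hence
no correspondence from which such a chain could be read off — is known (the Hodge conjecture for
Fermat varieties of degree `33` is open; known degrees: primes, `4`, `≤ 21`, `27`, `p²`).
[cite: daSilva2021HodgeFermat, Prop. 3.6] -/
theorem fermat33_of_gammaHodgeSector (h : GammaHodgeSector) :
    Equivalent (cubeRep x33 y33 admissible_fermat33.pos)
      (ballCubeRep 3 Fin.elim0 Fin.elim0 c33 isAlgebraic_c33 admissible_elim0.pos) :=
  gammaHodgeSector_iff_canonical.mp h 5 0 3 x33 y33 Fin.elim0 Fin.elim0 c33 admissible_fermat33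
    admissible_elim0 hodgeCondition_fermat33 isAlgebraic_c33 deligneIdentity_fermat33

/-- The same instance in the crux's verbatim shape (all `c`, `r`, `r'`). [folklore] -/
theorem fermat33_of_gammaHodgeSector' (h : GammaHodgeSector) (c : ℝ) (hc : IsAlgebraic ℚ c)
    (r : IntegralRep 5) (r' : IntegralRep (2 * 3 + 0)) (hr : IsCubeBetaRep x33 y33 r)
    (hr' : IsBallCubeRep 3 Fin.elim0 Fin.elim0 c r') (hv : r.value = r'.value) : Equivalent r r' :=
  gammaHodgeSector_iff.mp h 5 0 3 x33 y33 Fin.elim0 Fin.elim0 c admissible_fermat33 admissible_elim0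
    hodgeCondition_fermat33 hc r r' hr hr' hv

/-- The two values, for the record: `value (cubeRep x33 y33) = Γ(7/33)⋯Γ(28/33)/2 = value [B⁶, 6c₃₃]`.
[folklore] -/
theorem fermat33_values :
    (cubeRep x33 y33 admissible_fermat33.pos).value =
        Real.Gamma (7 / 33) * Real.Gamma (10 / 33) * Real.Gamma (13 / 33) * Real.Gamma (19 / 33) *
          Real.Gamma (22 / 33) * Real.Gamma (28 / 33) / 2 ∧
      (ballCubeRep 3 Fin.elim0 Fin.elim0 c33 isAlgebraic_c33 admissible_elim0.pos).value =
        (cubeRep x33 y33 admissible_fermat33.pos).value := by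
  refine ⟨by rw [cubeRep_value, prod_beta_fermat33], ?_⟩
  rw [ballCubeRep_value, cubeRep_value]
  exact deligneIdentity_fermat33.symm

end Fermat33

end Summit.KontsevichZagierPeriods.GammaHodgeSectorNegative
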